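import Summits.AnomalousDissipation.AnomalousDissipation.Cruxes.SteadyStatesLoudBounded.CensusSketchV3
import Summits.AnomalousDissipation.AnomalousDissipation.Cruxes.SteadyStatesLoudBounded.Disproof
import Summits.AnomalousDissipation.AnomalousDissipation.Theorems.SteadyStatesLoudBounded.Negative.SteadyStatesLoudBoundedFalseOfSteadyStatesAboveEverywhere
import Summits.AnomalousDissipation.AnomalousDissipation.Theses.CoherentStates
import HarnessLib.Audit

/-!
# Typed statements behind `STRATEGY-CENSUS.md` v4 (crux stmt-AnomalousDissipation-13038, crux-strategist seat s2, 2026-08-17)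

Companion of `CensusSketch.lean` (v2, seat s0) and `CensusSketchV3.lean` (v3, seat s1), whose vocabulary
(`IsCruxSteady`, `Body`, `SteadyCeilingAt`, `SteadyFloorInBallAt`, `SteadyStatesAbove`, `BoundedSteadyBranchAt`,
`SteadyFloorInBallBoundedSome`, …) is IMPORTED (namespace `…StrategyCensusV3`), not redefined. Also imported: the
cdisprove work file `Disproof.lean` (scaling covariance `isSteady_smul_iff`, pressure recovery `exists_pressure`),
the LANDED negative-modulo file `Theorems/SteadyStatesLoudBounded/Negative/…AboveEverywhere.lean` (p140020) and the
route file of `CoherentStates` (item stmt-0219 `SteadyZerothLaw`). Everything here is sorry-free.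

* §D6  NORMAL FORM of the crux (PROVED, classical logic over v3's split):
       `SteadyStatesLoudBounded ↔ ∃ f admissible ∃ E, ¬ SteadyStatesAbove f E ∧ ∃ ε₀ ν₀ > 0, SteadyFloorInBallAt f E ε₀ ν₀`
       and its negation `¬ crux ↔ ∀ f admissible ∀ E, SteadyStatesAbove f E ∨ (no floor in the E-ball)`.
       The first conjunct is a ν-UNIFORM A-PRIORI ENERGY BOUND on ALL steady states of one force — the piece that is
       the whole (dead) crux.
* §T8  TRANSFER / Reynolds-scaling dictionary (PROVED from Disproof §10): `U := ν • u` is a steady state of the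
       KOLMOGOROV PROBLEM `NS_{ν²}(ν² f)` (Reynolds number `ν⁻²`, force `∝ Re⁻¹`, laminar profile `O(1)`) iff `u` is a
       steady state of `NS_ν(f)`; the crux's CEILING conjunct is VERBATIM the statement "every steady state of the
       Kolmogorov problem of `f` has energy `≤ E·Re⁻¹`" (`steadyCeilingAt_iff_kolmogorovProblemSmallness`).
* §N12 NEGATION in Reynolds scaling: `LaminarPersistence f` (the Kolmogorov problem of `f` keeps an `O(1)`-energy steady
       state at arbitrarily large `Re`) gives `SteadyStatesAbove f E` for EVERY `E` (PROVED), hence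
       `LaminarPersistenceEverywhere → SteadyStatesAboveEverywhere → ¬ crux` over the landed p140020 (PROVED).
* §S8  STRENGTHEN by ORDER STRUCTURE (the Burgers/dyadic lesson as a hypothesis): `UniqueSteadyStates f ν₃` turns any
       loud bounded steady BRANCH into the crux body (PROVED) — exactly what uniqueness would buy, and why it buys
       nothing (false at f₁₂₃: four steady states at ν = 0.005; and fat wherever it is provable).
* §R4  LATTICE: crux ⇒ (R2) `SteadyFloorInBallBoundedSome` ⇒ `LoudBoundedSteadyBranch` ⇒ CoherentStates'
       `SteadyZerothLaw` (stmt-0219) — all PROVED (pressure recovery + constant classical path); so the minimal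
       steady statement is ALREADY an item on two other routes, and (R2)'s only content beyond it is the ∀-FLOOR IN
       THE BALL.
-/

noncomputable section

set_option linter.dupNamespace false

namespace Summit.AnomalousDissipation.AnomalousDissipation.Cruxes.SteadyStatesLoudBounded.StrategyCensusV4

open MeasureTheory Filter Topology UnitAddTorus
open scoped InnerProductSpace ENNReal
open Literature.Analysis.FunctionSpaces Literature.Analysis.FluidPDE
open Summit.AnomalousDissipation.AnomalousDissipation.Theses.TaylorCertificates
open Summit.AnomalousDissipation.AnomalousDissipation.Theses.CoherentStates (SteadyZerothLaw)
open Summit.AnomalousDissipation.AnomalousDissipation.Cruxes.SteadyStatesLoudBounded.StrategyCensusV3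
open Summit.AnomalousDissipation.AnomalousDissipation.Cruxes.SteadyStatesLoudBounded.Disproof (IsSteady isSteady_smul_iff exists_pressure)
open Summit.AnomalousDissipation.AnomalousDissipation.Theorems.SteadyStatesLoudBounded (Negative.SteadyStatesAboveEverywhere Negative.SteadyStatesLoudBounded_false_of_SteadyStatesAboveEverywhere)

/-- Local notation: real vector fields on `T³`. -/
local notation "Vec3" => ((UnitAddTorus (Fin 3)) → (EuclideanSpace ℝ (Fin 3)))
/-- Local notation: the torus. -/
local notation "𝕋³" => (UnitAddTorus (Fin 3))

/-! ## §D6 Normal form: the crux is (a ν-uniform a-priori energy bound on ALL steady states) ∧ (floor in the ball) -/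

/-- A ceiling at level `E` below some `ν₁` is EXACTLY the negation of "steady states above `E` at arbitrarily small
viscosity" (classical logic; v3 had only the direction `not_ceiling_of_statesAbove`). [folklore] -/
theorem exists_ceilingAt_iff_not_statesAbove (f : Vec3) (E : ℝ) :
    (∃ ν₁ : ℝ, 0 < ν₁ ∧ SteadyCeilingAt f E ν₁) ↔ ¬ SteadyStatesAbove f E := by
  constructor
  · intro h hA
    exact not_ceiling_of_statesAbove hA h
  · intro h
    by_contra hC
    apply h
    intro ν₀ hν₀
    by_contra hne
    apply hC
    refine ⟨ν₀, hν₀, fun ν hν hνlt u hus hud huz hst => ?_⟩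
    by_contra hE
    exact hne ⟨ν, hν, hνlt, u, hus, hud, huz, hst, not_le.mp hE⟩

/-- **D6 — NORMAL FORM OF THE CRUX (PROVED).** `SteadyStatesLoudBounded` holds iff some admissible force `f` and level
`E` have (i) NO steady states above `E` at small viscosity — a `ν`-uniform a-priori energy bound on ALL steady states
of `NS_ν(f)` — and (ii) a floor in the `E`-ball. Conjunct (i) is the piece that is the whole crux: no `ν`-uniform
upper a-priori bound on steady Navier–Stokes states is known for any force (the only uniform bounds are LOWER ones,
Disproof §12), and §T8 shows (i) is the absurd-looking statement "all steady states of the Kolmogorov problem of `f`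
have energy `O(Re⁻¹)`". [folklore] -/
theorem crux_iff_notAbove_floorInBall :
    SteadyStatesLoudBounded ↔ ∃ f : Vec3, Torus.IsSmooth f ∧ Torus.IsDivFree f ∧ Torus.HasZeroMean f ∧
      ∃ E : ℝ, ¬ SteadyStatesAbove f E ∧ ∃ ε₀ ν₀ : ℝ, 0 < ε₀ ∧ 0 < ν₀ ∧ SteadyFloorInBallAt f E ε₀ ν₀ := by
  constructor
  · rintro ⟨f, hfs, hfd, hfz, ε₀, E, ν₀, hε₀, hν₀, hall⟩
    refine ⟨f, hfs, hfd, hfz, E, ?_, ε₀, ν₀, hε₀, hν₀, ?_⟩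
    · rw [← exists_ceilingAt_iff_not_statesAbove]
      exact ⟨ν₀, hν₀, fun ν hν hνlt u hus hud huz hst => (hall ν hν hνlt u hus hud huz hst).2⟩
    · exact fun ν hν hνlt u hus hud huz hst _ => (hall ν hν hνlt u hus hud huz hst).1
  · rintro ⟨f, hfs, hfd, hfz, E, hnA, ε₀, ν₀, hε₀, hν₀, hF⟩
    obtain ⟨ν₁, hν₁, hC⟩ := (exists_ceilingAt_iff_not_statesAbove f E).2 hnA
    exact crux_of_ceiling_floorInBall ⟨hfs, hfd, hfz⟩ hε₀ hν₀ hν₁ hC hF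

/-- **The universal shape of a refutation (PROVED):** `¬ crux` iff EVERY admissible force, at EVERY level `E`, has steady
states above `E` at arbitrarily small `ν` OR no floor in the `E`-ball. (What cdisprove must produce; `f = 0` takes the
second disjunct, every eigen/Beltrami/unidirectional/planar-compatible force the first, Disproof §6–§9.) [folklore] -/
theorem not_crux_iff :
    ¬ SteadyStatesLoudBounded ↔ ∀ f : Vec3, Torus.IsSmooth f → Torus.IsDivFree f → Torus.HasZeroMean f →
      ∀ E : ℝ, SteadyStatesAbove f E ∨ ∀ ε₀ ν₀ : ℝ, 0 < ε₀ → 0 < ν₀ → ¬ SteadyFloorInBallAt f E ε₀ ν₀ := by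
  rw [crux_iff_notAbove_floorInBall]
  constructor
  · intro h f hfs hfd hfz E
    by_cases hA : SteadyStatesAbove f E
    · exact Or.inl hA
    · refine Or.inr fun ε₀ ν₀ hε₀ hν₀ hF => ?_
      exact h ⟨f, hfs, hfd, hfz, E, hA, ε₀, ν₀, hε₀, hν₀, hF⟩
  · rintro h ⟨f, hfs, hfd, hfz, E, hnA, ε₀, ν₀, hε₀, hν₀, hF⟩
    rcases h f hfs hfd hfz E with hA | hN
    · exact hnA hA
    · exact hN ε₀ ν₀ hε₀ hν₀ hF

/-! ## §T8 Transfer — the Reynolds-scaling dictionary to the Kolmogorov problem -/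

/-- The crux's weak form is the disprover's `IsSteady` at `d = Fin 3` (definitionally). [folklore] -/
theorem isCruxSteady_iff_isSteady (ν : ℝ) (f u : Vec3) : IsCruxSteady ν f u ↔ IsSteady ν f u := Iff.rfl

/-- **REYNOLDS SCALING (PROVED from Disproof §10 `isSteady_smul_iff` with `a = ν`).** `U := ν • u` is a steady state of
`NS_{ν²}(ν² • f)` — viscosity `ν² = Re⁻¹`, force `f/Re`, i.e. the classical KOLMOGOROV PROBLEM in which the laminar
profile of every forced line is `O(1)` and `ν`-independent — iff `u` is a steady state of `NS_ν(f)`. So the crux's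
steady states at Grashof number `≍ ν⁻²` ARE the steady states of the Kolmogorov problem at Reynolds number `ν⁻²`,
magnified by `ν⁻¹`: fat branches `∫|u|² ≍ ν⁻²` ↔ `O(1)` Kolmogorov states; the crux's `O(1)` loud bounded states ↔
Kolmogorov states of energy `O(Re⁻¹)`. [folklore] -/
theorem reynolds_covariance {ν : ℝ} (hν : ν ≠ 0) {f u : Vec3} (hu : Torus.IsSmooth u) :
    IsCruxSteady (ν ^ 2) (ν ^ 2 • f) (ν • u) ↔ IsCruxSteady ν f u := by
  rw [isCruxSteady_iff_isSteady, isCruxSteady_iff_isSteady, isSteady_smul_iff hν hu]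
  have : ν ^ 2 / ν = ν := by rw [sq, mul_div_assoc, div_self hν, mul_one]
  rw [this]

/-- Energy of a rescaled field: `∫ ‖(c • U) x‖² = c² ∫ ‖U x‖²`. [folklore] -/
theorem integral_norm_sq_smul (c : ℝ) (U : Vec3) : (∫ x, ‖(c • U) x‖ ^ 2) = c ^ 2 * ∫ x, ‖U x‖ ^ 2 := by
  rw [← integral_const_mul]
  refine integral_congr_ae (ae_of_all _ fun x => ?_)
  show ‖(c • U) x‖ ^ 2 = c ^ 2 * ‖U x‖ ^ 2
  rw [Pi.smul_apply, norm_smul, mul_pow, Real.norm_eq_abs, sq_abs]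

/-- Admissibility is scale invariant (smoothness, solenoidality, zero mean of `c • U`). [folklore] -/
theorem admissible_smul (c : ℝ) {U : Vec3} (hUs : Torus.IsSmooth U) (hUd : Torus.IsDivFree U) (hUz : Torus.HasZeroMean U) :
    Torus.IsSmooth (c • U) ∧ Torus.IsDivFree (c • U) ∧ Torus.HasZeroMean (c • U) :=
  ⟨hUs.smul c, Literature.Analysis.FluidPDE.Torus.isDivFree_const_smul (hUs.isContDiff (by simp)) hUd c,
    Literature.Analysis.FluidPDE.Torus.hasZeroMean_const_smul hUz c⟩

/-- **T8 — THE CRUX'S CEILING IN REYNOLDS SCALING**: every admissible steady state `U` of the Kolmogorov problem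
`NS_{ν²}(ν² • f)` with `ν ∈ (0, ν₁)` has energy `≤ E ν²` (i.e. `≤ E · Re⁻¹`). [folklore] -/
def KolmogorovProblemSmallness (f : Vec3) (E ν₁ : ℝ) : Prop :=
  ∀ ν : ℝ, 0 < ν → ν < ν₁ → ∀ U : Vec3, Torus.IsSmooth U → Torus.IsDivFree U → Torus.HasZeroMean U →
    IsCruxSteady (ν ^ 2) (ν ^ 2 • f) U → ∫ x, ‖U x‖ ^ 2 ≤ E * ν ^ 2

/-- **The ceiling conjunct of the crux at `f`, `E` is VERBATIM the smallness of ALL Kolmogorov-problem steady states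
(PROVED).** In the sibling's own variables the statement to be proved for SOME force is: "at large Reynolds number the
body-forced periodic Kolmogorov problem of shape `f` has NO steady state of energy `≫ Re⁻¹`" — contradicted at the
laminar state of every forced line (exact for eigen/Beltrami/unidirectional/planar-compatible `f`, Disproof §6–§9;
numerically at `f_GP`, `f₁₂₃`), and the opposite of everything the Kolmogorov-flow literature computes
(Meshalkin–Sinai 1961, Iudovich 1965, Okamoto–Shōji 1993, Kim–Okamoto 2010/2015: `O(1)` steady states persist and
PROLIFERATE as `Re → ∞`). [folklore] -/
theorem steadyCeilingAt_iff_kolmogorovProblemSmallness (f : Vec3) (E ν₁ : ℝ) :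
    SteadyCeilingAt f E ν₁ ↔ KolmogorovProblemSmallness f E ν₁ := by
  constructor
  · intro hC ν hν hνlt U hUs hUd hUz hst
    obtain ⟨hus, hud, huz⟩ := admissible_smul ν⁻¹ hUs hUd hUz
    have hUeq : ν • (ν⁻¹ • U) = U := by rw [smul_smul, mul_inv_cancel₀ hν.ne', one_smul]
    have hst' : IsCruxSteady ν f (ν⁻¹ • U) := by
      rw [← reynolds_covariance hν.ne' hus, hUeq]
      exact hst
    have hE := hC ν hν hνlt (ν⁻¹ • U) hus hud huz hst'
    rw [integral_norm_sq_smul] at hE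
    have hν2 : 0 < ν ^ 2 := by positivity
    have h1 : ν ^ 2 * ((ν⁻¹) ^ 2 * ∫ x, ‖U x‖ ^ 2) ≤ ν ^ 2 * E := mul_le_mul_of_nonneg_left hE hν2.le
    have h2 : ν ^ 2 * ((ν⁻¹) ^ 2 * ∫ x, ‖U x‖ ^ 2) = ∫ x, ‖U x‖ ^ 2 := by
      rw [← mul_assoc, ← mul_pow, mul_inv_cancel₀ hν.ne', one_pow, one_mul]
    rw [h2] at h1
    linarith
  · intro hK ν hν hνlt u hus hud huz hst
    obtain ⟨hUs, hUd, hUz⟩ := admissible_smul ν hus hud huz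
    have hst' : IsCruxSteady (ν ^ 2) (ν ^ 2 • f) (ν • u) := (reynolds_covariance hν.ne' hus).2 hst
    have hE := hK ν hν hνlt (ν • u) hUs hUd hUz hst'
    rw [integral_norm_sq_smul] at hE
    have hν2 : 0 < ν ^ 2 := by positivity
    exact le_of_mul_le_mul_left (by linarith) hν2

/-! ## §N12 Negation in Reynolds scaling — laminar persistence kills the crux at that force, at every level -/

/-- **LAMINAR PERSISTENCE at `f`** (Reynolds form of v2's `FatSteadyBranch`): the Kolmogorov problem of shape `f` keeps,
at arbitrarily large Reynolds number `ν⁻²`, an admissible steady state of energy `≥ c > 0`. Exact (the laminar state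
itself, `c` = its energy) for every eigen/Beltrami/unidirectional force; numerically TRUE at `f₁₂₃` (the blown-down
fat branch `U_ν = ν u_ν → sin(2πx₃)e₁/(4π²)`, `∫|U_ν|² → 3.18·10⁻⁴`, kit j022341/j022342, three codes) and at `f_GP`
(ABC ray). As a theorem: persistence of the Kolmogorov laminar state of the gravest fed line under an `O(Re⁻¹)`
body-force perturbation with an `O(Re^{-1/2})` velocity corrector — open (§N12 of the census). [folklore] -/
def LaminarPersistence (f : Vec3) : Prop :=
  ∃ c : ℝ, 0 < c ∧ ∀ ν₀ : ℝ, 0 < ν₀ → ∃ ν : ℝ, 0 < ν ∧ ν < ν₀ ∧ ∃ U : Vec3, Torus.IsSmooth U ∧ Torus.IsDivFree U ∧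
    Torus.HasZeroMean U ∧ IsCruxSteady (ν ^ 2) (ν ^ 2 • f) U ∧ c ≤ ∫ x, ‖U x‖ ^ 2

/-- **Laminar persistence ⇒ steady states above EVERY level (PROVED):** `u := ν⁻¹ • U` is a steady state of
`NS_ν(f)` of energy `ν⁻² ∫|U|² ≥ c ν⁻² > E` once `ν² < c/(|E|+1)`. [folklore] -/
theorem statesAbove_of_laminarPersistence {f : Vec3} (h : LaminarPersistence f) (E : ℝ) : SteadyStatesAbove f E := by
  obtain ⟨c, hc, h⟩ := h
  intro ν₀ hν₀
  have hE1 : 0 < |E| + 1 := by positivity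
  obtain ⟨ν, hν, hνlt, U, hUs, hUd, hUz, hst, hcU⟩ := h (min ν₀ (min 1 (c / (|E| + 1))))
    (lt_min hν₀ (lt_min one_pos (div_pos hc hE1)))
  have hν0 : ν < ν₀ := lt_of_lt_of_le hνlt (min_le_left _ _)
  have hν1 : ν < 1 := lt_of_lt_of_le hνlt ((min_le_right _ _).trans (min_le_left _ _))
  have hνc : ν < c / (|E| + 1) := lt_of_lt_of_le hνlt ((min_le_right _ _).trans (min_le_right _ _))
  obtain ⟨hus, hud, huz⟩ := admissible_smul ν⁻¹ hUs hUd hUz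
  have hUeq : ν • (ν⁻¹ • U) = U := by rw [smul_smul, mul_inv_cancel₀ hν.ne', one_smul]
  have hst' : IsCruxSteady ν f (ν⁻¹ • U) := by
    rw [← reynolds_covariance hν.ne' hus, hUeq]
    exact hst
  refine ⟨ν, hν, hν0, ν⁻¹ • U, hus, hud, huz, hst', ?_⟩
  rw [integral_norm_sq_smul]
  -- `E ν² < c ≤ ∫|U|²`, divided by `ν²`
  have hν2 : 0 < ν ^ 2 := by positivity
  have hνsq : ν ^ 2 < c / (|E| + 1) := by nlinarith
  have hEν : E * ν ^ 2 < c := by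
    have h1 : E * ν ^ 2 ≤ |E| * ν ^ 2 := mul_le_mul_of_nonneg_right (le_abs_self E) hν2.le
    have h2 : |E| * ν ^ 2 ≤ |E| * (c / (|E| + 1)) := mul_le_mul_of_nonneg_left hνsq.le (abs_nonneg E)
    have h3 : |E| * (c / (|E| + 1)) < c := by
      rw [mul_div_assoc', div_lt_iff₀ hE1]
      nlinarith [abs_nonneg E]
    linarith
  have h4 : E < (ν⁻¹) ^ 2 * c := by
    rw [inv_pow, ← div_eq_inv_mul, lt_div_iff₀ hν2]
    exact hEν
  have h5 : (ν⁻¹) ^ 2 * c ≤ (ν⁻¹) ^ 2 * ∫ x, ‖U x‖ ^ 2 := mul_le_mul_of_nonneg_left hcU (sq_nonneg _)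
  linarith

/-- **Laminar persistence at EVERY nonzero admissible force** — the Reynolds form of the universal hypothesis `H`. -/
def LaminarPersistenceEverywhere : Prop :=
  ∀ f : Vec3, Torus.IsSmooth f → Torus.IsDivFree f → Torus.HasZeroMean f → (∃ x, f x ≠ 0) → LaminarPersistence f

/-- It implies the landed hypothesis `H = SteadyStatesAboveEverywhere` of p140020 (PROVED; the two `SteadyStatesAbove`
are the same term). [folklore] -/
theorem steadyStatesAboveEverywhere_of_laminarPersistence (h : LaminarPersistenceEverywhere) :
    Negative.SteadyStatesAboveEverywhere :=
  fun f hfs hfd hfz hne E => statesAbove_of_laminarPersistence (h f hfs hfd hfz hne) E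

/-- **… hence kills the crux (PROVED over the landed negative-modulo theorem).** [folklore] -/
theorem not_crux_of_laminarPersistence (h : LaminarPersistenceEverywhere) : ¬ SteadyStatesLoudBounded :=
  Negative.SteadyStatesLoudBounded_false_of_SteadyStatesAboveEverywhere (steadyStatesAboveEverywhere_of_laminarPersistence h)

/-- And at a single force it kills the crux body at that force (PROVED). [folklore] -/
theorem not_body_of_laminarPersistence {f : Vec3} (h : LaminarPersistence f) : ¬ Body f :=
  not_body_of_statesAbove_all (statesAbove_of_laminarPersistence h)

/-! ## §S8 Strengthen by order structure — what uniqueness of steady states would buy -/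

/-- **S8: UNIQUENESS of admissible steady states of `NS_ν(f)` for `ν ∈ (0, ν₃)`** — the structural hypothesis behind
every sibling where the crux-analogue is TRUE (forced Burgers with mean-zero states: comparison principle; forced dyadic
model: monotone recursion). Numerically FALSE at `f₁₂₃` (four admissible steady states at `ν = 0.005`, lead c2 kit
j022329) and at `f_GP`; PROVED anywhere only (i) at small Grashof number (`ν² > c‖f‖_{V'}`, Temam 1979 Ch. II
Thm 1.3 — useless as `ν → 0`) and (ii) in 2-D for first-shell forces (Marchioro 1986, barrier decl
`Marchioro1986_globalAttraction.steadyState_ae_eq`), where the unique state is the FAT laminar one `f/(νλ₁)`. -/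
def UniqueSteadyStates (f : Vec3) (ν₃ : ℝ) : Prop :=
  ∀ ν : ℝ, 0 < ν → ν < ν₃ → ∀ u v : Vec3, Torus.IsSmooth u → Torus.IsDivFree u → Torus.HasZeroMean u →
    IsCruxSteady ν f u → Torus.IsSmooth v → Torus.IsDivFree v → Torus.HasZeroMean v → IsCruxSteady ν f v → u = v

/-- A LOUD BOUNDED STEADY STATE AT EVERY SMALL VISCOSITY (the `∀ν`-pinned body of CoherentStates' `SteadyZerothLaw`,
stmt-0219; = v3's `BoundedSteadyBranchAt` + loudness). -/
def LoudBoundedSteadyBranchAt (f : Vec3) (E ε₀ ν₂ : ℝ) : Prop :=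
  ∀ ν : ℝ, 0 < ν → ν < ν₂ → ∃ u : Vec3, Torus.IsSmooth u ∧ Torus.IsDivFree u ∧ Torus.HasZeroMean u ∧
    IsCruxSteady ν f u ∧ ∫ x, ‖u x‖ ^ 2 ≤ E ∧ ε₀ ≤ ν * Torus.gradNormSq u

/-- **What uniqueness would buy (PROVED):** with unique steady states, ONE loud bounded branch IS the crux body at that
force. This is the exact transfer step of the Burgers/dyadic siblings; it fails here twice — uniqueness is false at
every screened force, and the branch it would promote is fat wherever uniqueness is provable. [folklore] -/
theorem body_of_unique_loudBoundedBranch {f : Vec3} {E ε₀ ν₂ ν₃ : ℝ} (hε₀ : 0 < ε₀) (hν₂ : 0 < ν₂) (hν₃ : 0 < ν₃)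
    (hU : UniqueSteadyStates f ν₃) (hB : LoudBoundedSteadyBranchAt f E ε₀ ν₂) : Body f := by
  refine ⟨ε₀, E, min ν₂ ν₃, hε₀, lt_min hν₂ hν₃, fun ν hν hνlt v hvs hvd hvz hvst => ?_⟩
  obtain ⟨u, hus, hud, huz, hust, hE, hL⟩ := hB ν hν (lt_of_lt_of_le hνlt (min_le_left _ _))
  have huv : u = v := hU ν hν (lt_of_lt_of_le hνlt (min_le_right _ _)) u v hus hud huz hust hvs hvd hvz hvst
  subst huv
  exact ⟨hL, hE⟩

/-! ## §R4 The lattice: crux ⇒ (R2) ⇒ loud bounded branch ⇒ CoherentStates.SteadyZerothLaw (stmt-0219) -/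

/-- (R2) gives a loud bounded steady branch at its force (PROVED, one line: the bounded state of (ii) is in the ball,
so the floor (i) applies to it). [folklore] -/
theorem loudBoundedBranch_of_repair (h : SteadyFloorInBallBoundedSome) :
    ∃ f : Vec3, (Torus.IsSmooth f ∧ Torus.IsDivFree f ∧ Torus.HasZeroMean f) ∧
      ∃ E ε₀ ν₂ : ℝ, 0 < ε₀ ∧ 0 < ν₂ ∧ LoudBoundedSteadyBranchAt f E ε₀ ν₂ := by
  obtain ⟨f, hfs, hfd, hfz, ε₀, E, ν₀, hε₀, hν₀, hall⟩ := h
  refine ⟨f, ⟨hfs, hfd, hfz⟩, E, ε₀, ν₀, hε₀, hν₀, fun ν hν hνlt => ?_⟩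
  obtain ⟨hF, u, hus, hud, huz, hst, hE⟩ := hall ν hν hνlt
  exact ⟨u, hus, hud, huz, hst, hE, hF u hus hud huz hst hE⟩

/-- **Constant classical path (PROVED):** a smooth admissible steady state in the crux's weak sense, with its recovered
pressure (Disproof `exists_pressure`), is a time-independent `IsClassicalNSSolutionOn univ`. [folklore] -/
theorem isClassicalNSSolutionOn_const {ν : ℝ} {f u : Vec3} (hf : Torus.IsSmooth f) (hf0 : Torus.HasZeroMean f)
    (hu : Torus.IsSmooth u) (hud : Torus.IsDivFree u) (hst : IsCruxSteady ν f u) :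
    ∃ p : 𝕋³ → ℝ, Torus.IsClassicalNSSolutionOn Set.univ ν (fun _ => f) (fun _ => u) (fun _ => p) := by
  obtain ⟨p, hp, heq⟩ := exists_pressure hf hf0 hu hud ((isCruxSteady_iff_isSteady ν f u).1 hst)
  refine ⟨p, Torus.isSmoothSpaceTimeOn_const hu _, Torus.isSmoothSpaceTimeOn_const hp _, ?_, fun t _ => hud⟩
  intro t _ x
  have h0 : Torus.timeDerivWithin Set.univ (fun _ : ℝ => u) t x = 0 := by
    simp [Torus.timeDerivWithin]
  rw [h0, zero_add, ← heq x]
  abel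

/-- Viscosities `ν₂/(j+2)`: positive, below `ν₂`, tending to `0`. [folklore] -/
theorem seq_facts {ν₂ : ℝ} (hν₂ : 0 < ν₂) :
    (∀ j : ℕ, 0 < ν₂ / ((j : ℝ) + 2)) ∧ (∀ j : ℕ, ν₂ / ((j : ℝ) + 2) < ν₂) ∧
      Tendsto (fun j : ℕ => ν₂ / ((j : ℝ) + 2)) atTop (𝓝 0) := by
  refine ⟨fun j => div_pos hν₂ (by positivity), fun j => ?_, ?_⟩
  · have hj : (0 : ℝ) < (j : ℝ) + 2 := by positivity
    rw [div_lt_iff₀ hj]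
    nlinarith
  · have h1 : Tendsto (fun j : ℕ => ((j : ℝ) + 2)⁻¹) atTop (𝓝 0) :=
      tendsto_inv_atTop_zero.comp (tendsto_atTop_add_const_right atTop (2 : ℝ) tendsto_natCast_atTop_atTop)
    have h2 : Tendsto (fun j : ℕ => ν₂ * ((j : ℝ) + 2)⁻¹) atTop (𝓝 (ν₂ * 0)) := h1.const_mul ν₂
    rw [mul_zero] at h2
    simpa [div_eq_mul_inv] using h2

/-- **A loud bounded steady branch is CoherentStates' `SteadyZerothLaw` (stmt-0219) (PROVED):** sample `ν_j = ν₂/(j+2)`,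
recover the pressures, view each state as a constant classical solution. [folklore] -/
theorem steadyZerothLaw_of_loudBoundedBranch {f : Vec3} (hf : Torus.IsSmooth f ∧ Torus.IsDivFree f ∧ Torus.HasZeroMean f)
    {E ε₀ ν₂ : ℝ} (hε₀ : 0 < ε₀) (hν₂ : 0 < ν₂) (hB : LoudBoundedSteadyBranchAt f E ε₀ ν₂) : SteadyZerothLaw := by
  obtain ⟨hpos, hlt, hlim⟩ := seq_facts hν₂
  have key : ∀ j : ℕ, ∃ (u : Vec3) (p : 𝕋³ → ℝ),
      Torus.IsClassicalNSSolutionOn Set.univ (ν₂ / ((j : ℝ) + 2)) (fun _ => f) (fun _ => u) (fun _ => p) ∧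
        ∫ x, ‖u x‖ ^ 2 ≤ E ∧ ε₀ ≤ ν₂ / ((j : ℝ) + 2) * Torus.gradNormSq u := by
    intro j
    obtain ⟨u, hus, hud, huz, hst, hE, hL⟩ := hB _ (hpos j) (hlt j)
    obtain ⟨p, hcl⟩ := isClassicalNSSolutionOn_const hf.1 hf.2.2 hus hud hst
    exact ⟨u, p, hcl, hE, hL⟩
  choose u p hu using key
  exact ⟨f, hf.1, hf.2.1, hf.2.2, fun j => ν₂ / ((j : ℝ) + 2), u, p, hpos, hlim, fun j => (hu j).1,
    ⟨E, fun j => (hu j).2.1⟩, ε₀, hε₀, fun j => (hu j).2.2⟩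

/-- **(R2) ⇒ stmt-0219 (PROVED).** The recommended restatement sits strictly between the crux and the existing rank-2
crux of route CoherentStates; its only content beyond 0219 is the ∀-FLOOR IN THE BALL. [folklore] -/
theorem steadyZerothLaw_of_repair (h : SteadyFloorInBallBoundedSome) : SteadyZerothLaw := by
  obtain ⟨f, hf, E, ε₀, ν₂, hε₀, hν₂, hB⟩ := loudBoundedBranch_of_repair h
  exact steadyZerothLaw_of_loudBoundedBranch hf hε₀ hν₂ hB

/-- **crux ⇒ stmt-0219 (PROVED; the refuter's evidence chain of 2026-08-15, now over v3's `repair_of_crux`).** -/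
theorem steadyZerothLaw_of_crux (h : SteadyStatesLoudBounded) : SteadyZerothLaw :=
  steadyZerothLaw_of_repair (repair_of_crux h)

/-- The same lattice read at a pinned force: floor-in-ball + bounded branch ⇒ loud bounded branch (PROVED). [folklore] -/
theorem loudBoundedBranchAt_of_floor_bounded {f : Vec3} {E ε₀ ν₀ ν₂ : ℝ}
    (hF : SteadyFloorInBallAt f E ε₀ ν₀) (hB : BoundedSteadyBranchAt f E ν₂) :
    LoudBoundedSteadyBranchAt f E ε₀ (min ν₀ ν₂) := by
  intro ν hν hνlt
  obtain ⟨u, hus, hud, huz, hst, hE⟩ := hB ν hν (lt_of_lt_of_le hνlt (min_le_right _ _))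
  exact ⟨u, hus, hud, huz, hst, hE, hF ν hν (lt_of_lt_of_le hνlt (min_le_left _ _)) u hus hud huz hst hE⟩

end Summit.AnomalousDissipation.AnomalousDissipation.Cruxes.SteadyStatesLoudBounded.StrategyCensusV4
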